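import Summits.NavierStokesRegularity.NavierStokesRegularity.Theorems.TypeIQuarterGateQuarterLawTypeIWindowLaw
import HarnessLib

/-!
# `TypeIQuarterGate`: OCTAVE SAMPLING — the quarter law at one time per backward octave is the
# whole quarter law (crux `QuarterLawTypeI`, stmt-NavierStokesRegularity-23726)

`--supports stmt-NavierStokesRegularity-23726` (helper).  The registered line `lorentz-upgrade` of the
crux K1 = `QuarterLawTypeI` is at its fixed point (its one open stub `stub_lorentzUpgrade` is the item
`LorentzUpgradeTypeI` (24108) ⟺ K1, tree `LorentzOfEnvelope.lorentzUpgradeTypeI_iff_quarterLawTypeI`),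
so this file isolates the WEAKEST SAMPLED FORM of K1's conclusion that already gives K1.

Along a classical Leray–Hopf solution on `[0,T)` from a rapidly decaying datum with the sup-norm
Type-I rate `√(T−t)‖u(t,x)‖ ≤ C√ν` near `T`, write `Z(t) := ∫‖curl u(t)‖²`.

* `lintegral_curl_sq_le_of_goodSlice` — **ONE GOOD SLICE CONTROLS ITS FORWARD OCTAVE**: if
  `Z(s) ≤ B/√(T−s)` at a time `s` past the onset of the rate, then for every later `t < T` with
  `T−s ≤ q(T−t)` (i.e. `t` at most `log q` further in the logarithmic clock `−log(T−t)`),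
  `Z(t) ≤ e^{C²(q−1)/2} B/√(T−t)`.  Mechanism: on `[s,t]` the rate bounds `|u| ≤ C√ν/√(T−t)`, so the
  two-time Serrin–Grönwall factor of the frame (tree
  `QuarterLawWindow.lintegral_frobeniusNormSq_le_exp_mul_of_bound`) is `exp(C²(t−s)/(2(T−t)))
  ≤ exp(C²(q−1)/2)` — the Type-I rate makes a backward octave exactly `q−1` Grönwall units long,
  uniformly in the scale.
* `quarterLaw_of_octaveSampled` — hence the quarter law on ALL of `[0,T)` follows from ONE good time
  per backward octave: if for some `K, q` and all `t` near `T` there is `s ∈ [0,t]` with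
  `T−s ≤ q(T−t)` (so `s ∈ [T−qδ, T−δ]`, `δ = T−t`) and `Z(s) ≤ K/√(T−s)`, then
  `∃ K', ∀ t ∈ [0,T), Z(t) ≤ K'/√(T−t)` (early times by the tree's `LorentzOfEnvelope.quarterLaw_of_eventually`).
* `quarterLaw_of_lacunarySeq` — the instrument form: the quarter law sampled along ANY sequence
  `t_n ↑ T` in `[0,T)` with bounded scale ratios `T−t_n ≤ q(T−t_{n+1})` is the whole quarter law.
* `octaveViolation_of_not_quarterLaw` — contrapositive, the SHAPE OF A VIOLATOR: if the quarter law
  fails along such a solution, then for EVERY constant `K` and EVERY ratio `q` there are `t`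
  arbitrarily close to `T` whose whole backward octave `{s ∈ [0,t] : T−s ≤ q(T−t)}` violates
  `Z(s) ≤ K/√(T−s)` at EVERY slice — failure of K1 is never sparse in the logarithmic clock.
* BY NAME: `quarterLawTypeI_iff_octaveSampled` and `quarterLawTypeI_iff_dyadic` — `QuarterLawTypeI` is
  equivalent to its octave-sampled form and to its DYADIC form (the bound only at the times
  `t_n = T − T/2^{n+1}`).

Placement: the tree's window reductions (`QuarterLawWindow.quarterLaw_of_terminalWindowLaw_of_rate`,
p820364; `QuarterLawBackwardWindow.quarterLawTypeI_of_backwardWindowLaw`, p823679) assume a bound on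
the window INTEGRAL `∫_{2t−T}^{t} Z` and extract a good slice by Chebyshev; here the good slice is the
hypothesis, so every window / half-Hölder / lacunary form factors through `quarterLaw_of_octaveSampled`.
Repair-census wording for 23726: the missing estimate is ONE slice bound `Z(s_n)√(T−s_n) ≤ K` per
backward octave, equivalently (p818591, p816056) a weak-`L³` bound or a scale-uniform ε-concentration
count at one time per octave.

HONEST FRAMING: compositions of tree theorems along a HYPOTHETICAL blow-up; `QuarterLawTypeI` (23726),
`LorentzUpgradeTypeI` (24108), `UniformConcentrationCountTypeI` (23970) remain OPEN; nothing about
Navier–Stokes regularity is claimed and no summit statement is proved. [folklore]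
-/

-- the problem directory repeats the summit name (`NavierStokesRegularity/NavierStokesRegularity`)
set_option linter.dupNamespace false

noncomputable section

open Set Filter Topology MeasureTheory
open scoped ENNReal NNReal

namespace Summit.NavierStokesRegularity.NavierStokesRegularity.Theorems

namespace QuarterLawOctave

open Literature.Analysis.FluidPDE
open Summit.NavierStokesRegularity.NavierStokesRegularity.Theorems.QuarterLawWindow
  (lintegral_frobeniusNormSq_le_exp_mul_of_bound lintegral_frobeniusNormSq_eq_lintegral_curl_sq
    exists_rate_of_isTypeIBlowup')

/-! ### One good slice controls its forward octave -/

/-- **One good slice controls its forward octave.** Along a classical Leray–Hopf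
rapidly-decaying-datum solution on `[0,T)` (`ν, T > 0`) with the rate `√(T−σ)‖u(σ,x)‖ ≤ C√ν` for
`σ ∈ (a₀,T)`, `C > 0`: if `0 ≤ s`, `a₀ < s ≤ t < T`, `T − s ≤ q(T − t)` and
`∫‖curl u(s)‖² ≤ B/√(T−s)` with `B ≥ 0`, then `∫‖curl u(t)‖² ≤ e^{C²(q−1)/2} B/√(T−t)`. [folklore] -/
theorem lintegral_curl_sq_le_of_goodSlice {ν T C q a₀ s t B : ℝ} (hν : 0 < ν) (hT : 0 < T)
    {u : ℝ → EuclideanSpace ℝ (Fin 3) → EuclideanSpace ℝ (Fin 3)}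
    {p : ℝ → EuclideanSpace ℝ (Fin 3) → ℝ}
    (hsol : IsClassicalNSSolutionOn (Ico 0 T) ν 0 u p) (hLH : IsLerayHopfOn T ν 0 (u 0) u)
    (hdec : HasRapidSpatialDecay (u 0)) (hC : 0 < C)
    (hrate : ∀ σ ∈ Ioo a₀ T, ∀ x, Real.sqrt (T - σ) * ‖u σ x‖ ≤ C * Real.sqrt ν)
    (hs0 : 0 ≤ s) (ha₀s : a₀ < s) (hst : s ≤ t) (htT : t < T)
    (hq : T - s ≤ q * (T - t)) (hB : 0 ≤ B)
    (hZs : ∫⁻ x, ‖curl (u s) x‖ₑ ^ 2 ≤ ENNReal.ofReal (B / Real.sqrt (T - s))) :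
    ∫⁻ x, ‖curl (u t) x‖ₑ ^ 2 ≤
      ENNReal.ofReal (Real.exp (C ^ 2 * (q - 1) / 2) * B / Real.sqrt (T - t)) := by
  set δ : ℝ := T - t with hδ
  have hδ0 : 0 < δ := by rw [hδ]; exact sub_pos.2 htT
  have hsδ : 0 < Real.sqrt δ := Real.sqrt_pos.2 hδ0
  have hTs : δ ≤ T - s := by rw [hδ]; linarith
  have hq1 : 1 ≤ q := by
    by_contra h
    push Not at h
    have : q * δ < 1 * δ := mul_lt_mul_of_pos_right h hδ0
    linarith
  have hsqrt_le : Real.sqrt δ ≤ Real.sqrt (T - s) := Real.sqrt_le_sqrt hTs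
  have hexp1 : 1 ≤ Real.exp (C ^ 2 * (q - 1) / 2) :=
    Real.one_le_exp (by nlinarith [sq_nonneg C])
  -- the target bound dominates `B/√(T−s)`
  have hassoc : Real.exp (C ^ 2 * (q - 1) / 2) * B / Real.sqrt δ =
      Real.exp (C ^ 2 * (q - 1) / 2) * (B / Real.sqrt δ) := mul_div_assoc _ _ _
  have hmono : B / Real.sqrt (T - s) ≤ Real.exp (C ^ 2 * (q - 1) / 2) * B / Real.sqrt δ := by
    rw [hassoc]
    calc B / Real.sqrt (T - s) ≤ B / Real.sqrt δ := div_le_div_of_nonneg_left hB hsδ hsqrt_le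
      _ = 1 * (B / Real.sqrt δ) := (one_mul _).symm
      _ ≤ Real.exp (C ^ 2 * (q - 1) / 2) * (B / Real.sqrt δ) :=
          mul_le_mul_of_nonneg_right hexp1 (by positivity)
  rcases hst.eq_or_lt with rfl | hst'
  · exact hZs.trans (ENNReal.ofReal_le_ofReal hmono)
  -- `s < t`: the sup bound `|u| ≤ C√ν/√δ` on `[s,t] × ℝ³`
  set M : ℝ := C * Real.sqrt ν / Real.sqrt δ with hM_def
  have hM0 : 0 < M := by positivity
  have hbd : ∀ σ ∈ Icc s t, ∀ x, ‖u σ x‖ ≤ M := by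
    intro σ hσ x
    have hσT : σ < T := hσ.2.trans_lt htT
    have hσa₀ : a₀ < σ := ha₀s.trans_le hσ.1
    have hsσ : 0 < Real.sqrt (T - σ) := Real.sqrt_pos.2 (sub_pos.2 hσT)
    have h1 := hrate σ ⟨hσa₀, hσT⟩ x
    have h2 : ‖u σ x‖ ≤ C * Real.sqrt ν / Real.sqrt (T - σ) := by
      rw [le_div_iff₀ hsσ, mul_comm]; exact h1
    refine h2.trans ?_
    rw [hM_def]
    exact div_le_div_of_nonneg_left (by positivity) hsδ
      (Real.sqrt_le_sqrt (by rw [hδ]; linarith [hσ.2]))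
  have hsT : s ∈ Ico 0 T := ⟨hs0, hst'.trans htT⟩
  have htI : t ∈ Ico 0 T := ⟨hs0.trans hst, htT⟩
  -- Grönwall from `s` to `t`
  have hgr := lintegral_frobeniusNormSq_le_exp_mul_of_bound hν hsol hLH hdec hs0 hst' htT hM0 hbd
  rw [lintegral_frobeniusNormSq_eq_lintegral_curl_sq hν hT hsol hLH hdec htI,
    lintegral_frobeniusNormSq_eq_lintegral_curl_sq hν hT hsol hLH hdec hsT] at hgr
  -- its factor is at most `e^{C²(q−1)/2}`
  have hexp : Real.exp (M ^ 2 * (t - s) / (2 * ν)) ≤ Real.exp (C ^ 2 * (q - 1) / 2) := by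
    refine Real.exp_le_exp.2 ?_
    have hts : t - s ≤ (q - 1) * δ := by rw [hδ]; linarith
    have hM2 : M ^ 2 = C ^ 2 * ν / δ := by
      rw [hM_def, div_pow, mul_pow, Real.sq_sqrt hν.le, Real.sq_sqrt hδ0.le]
    have h1 : C ^ 2 * ν / δ * (t - s) ≤ C ^ 2 * ν / δ * ((q - 1) * δ) :=
      mul_le_mul_of_nonneg_left hts (by positivity)
    have h2 : C ^ 2 * ν / δ * ((q - 1) * δ) = C ^ 2 * (q - 1) * ν := by
      field_simp
    rw [hM2, div_le_div_iff₀ (by positivity) (by norm_num)]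
    nlinarith [h1, h2, hν]
  calc ∫⁻ x, ‖curl (u t) x‖ₑ ^ 2
      ≤ ENNReal.ofReal (Real.exp (M ^ 2 * (t - s) / (2 * ν))) * ∫⁻ x, ‖curl (u s) x‖ₑ ^ 2 := hgr
    _ ≤ ENNReal.ofReal (Real.exp (C ^ 2 * (q - 1) / 2)) *
          ENNReal.ofReal (B / Real.sqrt (T - s)) :=
        mul_le_mul' (ENNReal.ofReal_le_ofReal hexp) hZs
    _ = ENNReal.ofReal (Real.exp (C ^ 2 * (q - 1) / 2) * (B / Real.sqrt (T - s))) :=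
        (ENNReal.ofReal_mul (Real.exp_pos _).le).symm
    _ ≤ ENNReal.ofReal (Real.exp (C ^ 2 * (q - 1) / 2) * B / Real.sqrt δ) := by
        refine ENNReal.ofReal_le_ofReal ?_
        rw [hassoc]
        exact mul_le_mul_of_nonneg_left (div_le_div_of_nonneg_left hB hsδ hsqrt_le)
          (Real.exp_pos _).le

/-! ### Octave sampling ⟹ the slice law on `[0,T)` -/

/-- **Octave sampling gives the quarter law.** Along a classical Leray–Hopf rapidly-decaying-datum
solution on `[0,T)` (`ν, T > 0`) with eventual rate `√(T−t)‖u(t,x)‖ ≤ C√ν`: if for some `K, q, t₀ < T`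
every `t ∈ [t₀,T)` admits a time `s ∈ [0,t]` of its backward `q`-octave (`T−s ≤ q(T−t)`) with
`∫‖curl u(s)‖² ≤ K/√(T−s)`, then `∫‖curl u(t)‖² ≤ K'/√(T−t)` for all `t ∈ [0,T)`. [folklore] -/
theorem quarterLaw_of_octaveSampled {ν T C : ℝ} (hν : 0 < ν) (hT : 0 < T)
    {u : ℝ → EuclideanSpace ℝ (Fin 3) → EuclideanSpace ℝ (Fin 3)}
    {p : ℝ → EuclideanSpace ℝ (Fin 3) → ℝ}
    (hsol : IsClassicalNSSolutionOn (Ico 0 T) ν 0 u p) (hLH : IsLerayHopfOn T ν 0 (u 0) u)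
    (hdec : HasRapidSpatialDecay (u 0))
    (hrate : ∀ᶠ t in 𝓝[<] T, ∀ x, Real.sqrt (T - t) * ‖u t x‖ ≤ C * Real.sqrt ν)
    (hoct : ∃ K q t₀ : ℝ, t₀ < T ∧ ∀ t ∈ Ico t₀ T, ∃ s ∈ Icc 0 t, T - s ≤ q * (T - t) ∧
      ∫⁻ x, ‖curl (u s) x‖ₑ ^ 2 ≤ ENNReal.ofReal (K / Real.sqrt (T - s))) :
    ∃ K : ℝ, ∀ t ∈ Ico 0 T,
      ∫⁻ x, ‖curl (u t) x‖ₑ ^ 2 ≤ ENNReal.ofReal (K / Real.sqrt (T - t)) := by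
  obtain ⟨K, q, t₀, ht₀T, hK⟩ := hoct
  -- the onset of the rate, and a positive rate constant `C' = max C 1`
  obtain ⟨a₀, ha₀T, hsub⟩ := mem_nhdsLT_iff_exists_Ioo_subset.1 hrate
  set C' : ℝ := max C 1 with hC'
  have hC'0 : 0 < C' := lt_of_lt_of_le one_pos (le_max_right _ _)
  have hrate' : ∀ σ ∈ Ioo a₀ T, ∀ x, Real.sqrt (T - σ) * ‖u σ x‖ ≤ C' * Real.sqrt ν :=
    fun σ hσ x => (hsub hσ x).trans
      (mul_le_mul_of_nonneg_right (le_max_left _ _) (Real.sqrt_nonneg _))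
  -- nonnegative / normalised constants
  set K' : ℝ := max K 0 with hK'
  have hK'0 : 0 ≤ K' := le_max_right _ _
  set Q : ℝ := max q 1 with hQ
  have hQ0 : 0 < Q := lt_of_lt_of_le one_pos (le_max_right _ _)
  have hQne : Q ≠ 0 := hQ0.ne'
  -- the final window `[t₁,T)`: there the good slice lies past the onset `a₀`
  set m : ℝ := max a₀ 0 with hm
  have hmT : m < T := max_lt ha₀T hT
  have hpos : 0 < (T - m) / (2 * Q) := div_pos (sub_pos.2 hmT) (by positivity)
  set t₁ : ℝ := max t₀ (T - (T - m) / (2 * Q)) with ht₁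
  have ht₁T : t₁ < T := max_lt ht₀T (by linarith)
  refine LorentzOfEnvelope.quarterLaw_of_eventually hν hT hsol hLH hdec
    ⟨Real.exp (C' ^ 2 * (Q - 1) / 2) * K', t₁, ht₁T, fun t ht => ?_⟩
  have htT : t < T := ht.2
  have ht₀t : t₀ ≤ t := (le_max_left _ _).trans ht.1
  obtain ⟨s, hs, hqs, hZs⟩ := hK t ⟨ht₀t, htT⟩
  have hδ0 : 0 < T - t := sub_pos.2 htT
  have hQs : T - s ≤ Q * (T - t) :=
    hqs.trans (mul_le_mul_of_nonneg_right (le_max_left _ _) hδ0.le)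
  -- the good slice lies past the onset
  have ha₀s : a₀ < s := by
    have h1 : T - t ≤ (T - m) / (2 * Q) := by
      have := (le_max_right t₀ (T - (T - m) / (2 * Q))).trans ht.1
      linarith
    have h2 : Q * (T - t) ≤ (T - m) / 2 := by
      calc Q * (T - t) ≤ Q * ((T - m) / (2 * Q)) := mul_le_mul_of_nonneg_left h1 hQ0.le
        _ = (T - m) / 2 := by field_simp
    have h3 : a₀ ≤ m := le_max_left _ _
    linarith [hQs]
  have hZs' : ∫⁻ x, ‖curl (u s) x‖ₑ ^ 2 ≤ ENNReal.ofReal (K' / Real.sqrt (T - s)) :=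
    hZs.trans (ENNReal.ofReal_le_ofReal
      (div_le_div_of_nonneg_right (le_max_left _ _) (Real.sqrt_nonneg _)))
  exact lintegral_curl_sq_le_of_goodSlice hν hT hsol hLH hdec hC'0 hrate' hs.1 ha₀s hs.2 htT hQs
    hK'0 hZs'

/-- **Lacunary sampling gives the quarter law** (instrument form). Same frame and rate; if along
SOME sequence of times `t_n ∈ [0,T)`, `t_n → T`, with bounded scale ratios `T − t_n ≤ q(T − t_{n+1})`,
the samples obey `∫‖curl u(t_n)‖² ≤ K/√(T−t_n)`, then the quarter law holds on all of `[0,T)`.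
[folklore] -/
theorem quarterLaw_of_lacunarySeq {ν T C : ℝ} (hν : 0 < ν) (hT : 0 < T)
    {u : ℝ → EuclideanSpace ℝ (Fin 3) → EuclideanSpace ℝ (Fin 3)}
    {p : ℝ → EuclideanSpace ℝ (Fin 3) → ℝ}
    (hsol : IsClassicalNSSolutionOn (Ico 0 T) ν 0 u p) (hLH : IsLerayHopfOn T ν 0 (u 0) u)
    (hdec : HasRapidSpatialDecay (u 0))
    (hrate : ∀ᶠ t in 𝓝[<] T, ∀ x, Real.sqrt (T - t) * ‖u t x‖ ≤ C * Real.sqrt ν)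
    (t_ : ℕ → ℝ) (ht_mem : ∀ n, t_ n ∈ Ico 0 T) (ht_lim : Tendsto t_ atTop (𝓝 T))
    (hlac : ∃ q : ℝ, ∀ n, T - t_ n ≤ q * (T - t_ (n + 1)))
    (hZ : ∃ K : ℝ, ∀ n,
      ∫⁻ x, ‖curl (u (t_ n)) x‖ₑ ^ 2 ≤ ENNReal.ofReal (K / Real.sqrt (T - t_ n))) :
    ∃ K : ℝ, ∀ t ∈ Ico 0 T,
      ∫⁻ x, ‖curl (u t) x‖ₑ ^ 2 ≤ ENNReal.ofReal (K / Real.sqrt (T - t)) := by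
  obtain ⟨q, hq⟩ := hlac
  obtain ⟨K, hK⟩ := hZ
  have hq0 : 0 ≤ q := by
    by_contra h
    push Not at h
    have h0 : 0 < T - t_ 0 := sub_pos.2 (ht_mem 0).2
    have h1 : 0 < T - t_ 1 := sub_pos.2 (ht_mem 1).2
    nlinarith [hq 0]
  refine quarterLaw_of_octaveSampled hν hT hsol hLH hdec hrate
    ⟨K, q, t_ 0, (ht_mem 0).2, fun t ht => ?_⟩
  -- the first sample beyond `t`, and the sample just before it
  have hex : ∃ n, t < t_ n := (ht_lim.eventually (lt_mem_nhds ht.2)).exists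
  classical
  obtain ⟨m, hm, hmin⟩ : ∃ m, t < t_ m ∧ ∀ k < m, ¬ t < t_ k :=
    ⟨Nat.find hex, Nat.find_spec hex, fun k hk => Nat.find_min hex hk⟩
  have hm0 : m ≠ 0 := by
    rintro rfl
    linarith [ht.1]
  obtain ⟨n, rfl⟩ := Nat.exists_eq_succ_of_ne_zero hm0
  have hn_le : t_ n ≤ t := not_lt.1 (hmin n n.lt_succ_self)
  refine ⟨t_ n, ⟨(ht_mem n).1, hn_le⟩, ?_, hK n⟩
  calc T - t_ n ≤ q * (T - t_ (n + 1)) := hq n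
    _ ≤ q * (T - t) := mul_le_mul_of_nonneg_left (by linarith) hq0

/-! ### The shape of a violator -/

/-- **A violator breaks every constant on whole octaves.** Same frame and rate; if the quarter law
FAILS along the solution (no `K` with `∫‖curl u(t)‖² ≤ K/√(T−t)` on `[0,T)`), then for every `K`,
every ratio `q` and every `t₀ < T` there is `t ∈ [t₀,T)` such that EVERY slice `s ∈ [0,t]` of its
backward `q`-octave (`T−s ≤ q(T−t)`) has `∫‖curl u(s)‖² > K/√(T−s)`. [folklore] -/
theorem octaveViolation_of_not_quarterLaw {ν T C : ℝ} (hν : 0 < ν) (hT : 0 < T)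
    {u : ℝ → EuclideanSpace ℝ (Fin 3) → EuclideanSpace ℝ (Fin 3)}
    {p : ℝ → EuclideanSpace ℝ (Fin 3) → ℝ}
    (hsol : IsClassicalNSSolutionOn (Ico 0 T) ν 0 u p) (hLH : IsLerayHopfOn T ν 0 (u 0) u)
    (hdec : HasRapidSpatialDecay (u 0))
    (hrate : ∀ᶠ t in 𝓝[<] T, ∀ x, Real.sqrt (T - t) * ‖u t x‖ ≤ C * Real.sqrt ν)
    (hfail : ¬ ∃ K : ℝ, ∀ t ∈ Ico 0 T,
      ∫⁻ x, ‖curl (u t) x‖ₑ ^ 2 ≤ ENNReal.ofReal (K / Real.sqrt (T - t))) :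
    ∀ K q t₀ : ℝ, t₀ < T → ∃ t ∈ Ico t₀ T, ∀ s ∈ Icc 0 t, T - s ≤ q * (T - t) →
      ENNReal.ofReal (K / Real.sqrt (T - s)) < ∫⁻ x, ‖curl (u s) x‖ₑ ^ 2 := by
  intro K q t₀ ht₀
  by_contra hne
  push Not at hne
  exact hfail (quarterLaw_of_octaveSampled hν hT hsol hLH hdec hrate
    ⟨K, q, t₀, ht₀, fun t ht => by
      obtain ⟨s, hs, hqs, hZ⟩ := hne t ht
      exact ⟨s, hs, hqs, hZ⟩⟩)

/-! ### By name -/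

open Summit.NavierStokesRegularity.NavierStokesRegularity.Theses.TypeIQuarterGate

/-- **`QuarterLawTypeI` ⟺ its OCTAVE-SAMPLED form.** For the crux class of 23726 (maximal classical
Leray–Hopf solution from a rapidly decaying datum with the sup-norm Type-I rate), the quarter law on
`[0,T)` is equivalent to: some `K, q, t₀ < T` such that every `t ∈ [t₀,T)` has a slice `s ∈ [0,t]` of
its backward `q`-octave with `∫‖curl u(s)‖² ≤ K/√(T−s)`. [folklore] -/
theorem quarterLawTypeI_iff_octaveSampled :
    QuarterLawTypeI ↔
      ∀ (ν T : ℝ), 0 < ν → 0 < T →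
        ∀ (u : ℝ → EuclideanSpace ℝ (Fin 3) → EuclideanSpace ℝ (Fin 3))
          (p : ℝ → EuclideanSpace ℝ (Fin 3) → ℝ),
          IsMaximalSmoothSolution ν 0 u p T → IsLerayHopfOn T ν 0 (u 0) u →
          HasRapidSpatialDecay (u 0) → IsTypeIBlowup u T →
          ∃ K q t₀ : ℝ, t₀ < T ∧ ∀ t ∈ Ico t₀ T, ∃ s ∈ Icc 0 t, T - s ≤ q * (T - t) ∧
            ∫⁻ x, ‖curl (u s) x‖ₑ ^ 2 ≤ ENNReal.ofReal (K / Real.sqrt (T - s)) := by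
  constructor
  · intro h ν T hν hT u p hmax hLH hdec hI
    obtain ⟨K, hK⟩ := h ν T hν hT u p hmax hLH hdec hI
    exact ⟨K, 1, 0, hT, fun t ht => ⟨t, ⟨ht.1, le_rfl⟩, (one_mul (T - t)).ge, hK t ht⟩⟩
  · intro h ν T hν hT u p hmax hLH hdec hI
    obtain ⟨C, hC⟩ := exists_rate_of_isTypeIBlowup' hν hI
    exact quarterLaw_of_octaveSampled hν hT hmax.1 hLH hdec hC (h ν T hν hT u p hmax hLH hdec hI)

/-- **`QuarterLawTypeI` ⟺ its DYADIC form**: for the crux class of 23726 the quarter law on `[0,T)`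
is equivalent to the bound at the dyadic times `t_n = T − T/2^{n+1}` only,
`∫‖curl u(t_n)‖² ≤ K/√(T/2^{n+1})` for all `n`. [folklore] -/
theorem quarterLawTypeI_iff_dyadic :
    QuarterLawTypeI ↔
      ∀ (ν T : ℝ), 0 < ν → 0 < T →
        ∀ (u : ℝ → EuclideanSpace ℝ (Fin 3) → EuclideanSpace ℝ (Fin 3))
          (p : ℝ → EuclideanSpace ℝ (Fin 3) → ℝ),
          IsMaximalSmoothSolution ν 0 u p T → IsLerayHopfOn T ν 0 (u 0) u →
          HasRapidSpatialDecay (u 0) → IsTypeIBlowup u T →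
          ∃ K : ℝ, ∀ n : ℕ,
            ∫⁻ x, ‖curl (u (T - T / 2 ^ (n + 1))) x‖ₑ ^ 2 ≤
              ENNReal.ofReal (K / Real.sqrt (T / 2 ^ (n + 1))) := by
  constructor
  · intro h ν T hν hT u p hmax hLH hdec hI
    obtain ⟨K, hK⟩ := h ν T hν hT u p hmax hLH hdec hI
    refine ⟨K, fun n => ?_⟩
    have hpow : 0 < (2 : ℝ) ^ (n + 1) := by positivity
    have h1 : T / 2 ^ (n + 1) ≤ T := div_le_self hT.le (one_le_pow₀ (by norm_num))
    have h2 : 0 < T / 2 ^ (n + 1) := by positivity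
    have hmem : T - T / 2 ^ (n + 1) ∈ Ico 0 T := ⟨by linarith, by linarith⟩
    have := hK _ hmem
    rwa [sub_sub_cancel] at this
  · intro h ν T hν hT u p hmax hLH hdec hI
    obtain ⟨C, hC⟩ := exists_rate_of_isTypeIBlowup' hν hI
    obtain ⟨K, hK⟩ := h ν T hν hT u p hmax hLH hdec hI
    have hmem : ∀ n : ℕ, T - T / 2 ^ (n + 1) ∈ Ico 0 T := fun n => by
      have h1 : T / 2 ^ (n + 1) ≤ T := div_le_self hT.le (one_le_pow₀ (by norm_num))
      have h2 : 0 < T / 2 ^ (n + 1) := by positivity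
      exact ⟨by linarith, by linarith⟩
    refine quarterLaw_of_lacunarySeq hν hT hmax.1 hLH hdec hC (fun n => T - T / 2 ^ (n + 1)) hmem
      ?_ ⟨2, fun n => ?_⟩ ⟨K, fun n => ?_⟩
    · -- `T − T/2^{n+1} → T`
      have h0 : Tendsto (fun n : ℕ => T / 2 ^ (n + 1)) atTop (𝓝 0) := by
        have hg : Tendsto (fun n : ℕ => ((1 : ℝ) / 2) ^ (n + 1)) atTop (𝓝 0) :=
          (tendsto_pow_atTop_nhds_zero_of_lt_one (by norm_num) (by norm_num)).comp
            (tendsto_add_atTop_nat 1)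
        have := hg.const_mul T
        simp only [mul_zero] at this
        refine this.congr fun n => ?_
        rw [one_div, inv_pow, div_eq_mul_inv]
      have := h0.const_sub T
      simpa only [sub_zero] using this
    · -- scale ratio `2`
      rw [sub_sub_cancel, sub_sub_cancel, pow_succ]
      field_simp
      ring_nf
      rfl
    · rw [sub_sub_cancel]
      exact hK n

end QuarterLawOctave

end Summit.NavierStokesRegularity.NavierStokesRegularity.Theorems
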